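import Summits.QuantumFields.YangMills.Theorems.BalabanUVNodesN08AlphaEq324RowClassSocket

/-!
# Route «BalabanUVNodes», Track-A DAG node N08 = [Balaban1985UV3] Thm 1 p. 257 ∕ Thm 2 p. 272 — TWO KERNEL FACTS BEHIND THE CLASS SOCKET's COMPATIBILITY CHECK B
# («pad versus collar»): (1) a sup-`r`-PAD of a set `J` inside a finite frame `Λ ⊂ ℤ^d` is impossible as soon as `J` contains a coordinate-maximal point of `Λ` (in
# particular for `J = Λ ≠ ∅`); (2) at the socket's threshold `b = p(g)` the pad `p(g)²` exceeds ANY multiple `C·r(g)` of print's collar profile `r(g) = (1 + log g⁻¹)^{r₀}`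
# for all small couplings, for every constants record (`p₀ = 2r₀ + 1`)

Cell `pub-ymgap`, seat `pub-ymgap-dag-n08-w4` gen 5 (INTENT-3; companion of the located note `HOME/pub-ymgap-dag-n08-w4/N08-CLASS-SOCKET-PRESENTATION-g5.md` §3 = evidence #27 on
stmt-QuantumFields-27364).  `bears_on: R4∕N08`; filed `--supports stmt-QuantumFields-27364` (K1⁹, helper).  THEOREMS ONLY (def-free, sorry-free, standard axioms).

WHY.  The class road's signed Basic Lemma (n08-c CLAIM-20, design fixed INBOX l.37329) carries the admissibility letter «PAD»: `∀ x ∈ J, ∀ z, (∀ i, |z i − x i| ≤ b²) → z ∈ Λ` — the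
sup-`b²`-thickening of the Hamiltonian's support `J` lies inside the member's finite frame `Λ ⊂ ℤ^d` ([BenfattoEtAl1978]'s pavement side `L = b²`; print has `Λ = ℤ^d`, no boundary).
The (α)-socket (`…RowClassSocket.exists_h324Row_freeLetter_of_classSandwich`) consumes the lemma at `b = p(g_k) = b₀(1 + log g_k⁻¹)^{p₀}` ((41)∕(58)); [Balaban1985UV3]'s collars are
«distances to P > R M₁, R = R₁ r(g) = R₁(1 + log g⁻¹)^{r₀}» ((7) p. 257, (39) p. 266).  The note's CHECK B reads: (α) if `supp 𝒱_k` exhausts the frame, the pad fails outright; (β) a collar of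
`C·r(g_k)` sites never supplies a pad of `p(g_k)²` sites at small `g_k`.  This file makes both readings kernel facts about the typed letters (`B10.pFun`, `B10.rFun`, `AlphaConsts.p₀∕r₀∕b₀`):
* §1 `update_succ_mem_of_pad` (a pad of radius `r ≥ 1` around `J ⊆ ℤ^d` inside `Λ` puts `x + e_i ∈ Λ` for every `x ∈ J`), ★ `not_pad_of_coordMax_mem` (no pad of radius `≥ 1` if `J`
  contains a point maximizing a coordinate over `Λ`), ★ `not_pad_self` (`J = Λ ≠ ∅`: no pad — reading (α)), `not_pad_self_sq` (at `r = b²`, `1 ≤ b`).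
* §2 `rFun_pos`, `pFun_sq_eq`, ★ `mul_rFun_lt_pFun_sq_of_lt` (`C < b₀²·(1 + log g⁻¹)` and `r₀ + 1 ≤ 2p₀` ⇒ `C·r(g) < p(g)²`), ★★ `exists_coupling_mul_rFun_lt_pFun_sq`
  (`∃ g₁ ∈ (0,1], ∀ g ∈ (0,g₁], C·r(g) < p(g)²` — reading (β) for ANY collar constant `C`), ★★ `exists_coupling_collar_lt_pad_rec` (at every record `𝔠`: `p₀ = 2r₀ + 1` gives `r₀ + 1 ≤ 2p₀`),
  `collar_lt_pad_at_run` (at the run's couplings `g_k ≤ g₁`).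
HONEST SCOPE.  Elementary facts about binder letters; NOT a statement that [Balaban1985UV3]'s fluctuation integral is or is not an instance of the class lemma (that is the IDENT, class II ∕
NODE 00), NOT a defect of any landed module (every class-road file proves what it states), NO verdict on N08; count-neutral; N08 NOT discharged; `PrintedUV3V` NOT proved; one finite 𝕋⁴
programme at fixed ε — R4 closes the conditional finite-𝕋⁴ rung `BalabanLadder.UV` only; nothing continuum ∕ OS ∕ mass gap ∕ Clay.

References: [Balaban1985UV3] T. Bałaban, CMP 102 (1985) 255–275 — (7) p. 257, (39) p. 266, (41) p. 266, (58) p. 270; [BenfattoEtAl1978] G. Benfatto et al., CMP 59 (1978) 143–166 —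
Lemma p. 152, §5 p. 154 (pavements of side `b²`), p. 159 (`b*`).
-/

noncomputable section

namespace Summit.QuantumFields.YangMills.Theorems.BalabanUVNodesN08AlphaEq324RowClassSocketPad

open Literature.MathematicalPhysics.QuantumFieldTheory.Balaban1983to89
open Literature.MathematicalPhysics.QuantumFieldTheory.Balaban1985CMP102.Setting
open Summit.QuantumFields.Balaban3D.Carriers
open Summit.QuantumFields.Balaban3D.Proofs.ScalesArithmetic (gk_pos)
open Summit.QuantumFields.Balaban3D.Proofs.Primitives (AlphaConsts)

variable {L : ℕ}

/-! ## §1 A pad inside a finite frame is impossible at a coordinate-maximal point (reading (α)) -/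

section Pad

variable {d : ℕ}

/-- **One step of a pad**: if the sup-`r`-thickening (`r ≥ 1`) of `J` lies in `Λ`, then for every `x ∈ J` and direction `i` the neighbour `x + e_i` lies in `Λ`.
[cite: BenfattoEtAl1978, §5 p.154 (pavements; bookkeeping)] -/
theorem update_succ_mem_of_pad {J Λ : Finset (Fin d → ℤ)} {r : ℝ} (hr : 1 ≤ r)
    (hpad : ∀ x ∈ J, ∀ z : Fin d → ℤ, (∀ i, (|z i - x i| : ℝ) ≤ r) → z ∈ Λ) {x : Fin d → ℤ} (hx : x ∈ J) (i : Fin d) :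
    Function.update x i (x i + 1) ∈ Λ := by
  refine hpad x hx _ fun j => ?_
  by_cases hj : j = i
  · subst hj
    rw [Function.update_self]
    push_cast
    rw [add_sub_cancel_left, abs_one]
    exact hr
  · rw [Function.update_of_ne hj, sub_self, abs_zero]
    exact le_trans zero_le_one hr

/-- ★ **NO PAD AT A COORDINATE-MAXIMAL POINT**: if `J` contains a point `x` whose `i`-th coordinate is maximal over the finite frame `Λ`, then NO sup-`r`-pad (`r ≥ 1`) of `J` fits
inside `Λ` (the neighbour `x + e_i` would have to lie in `Λ`).  [BenfattoEtAl1978] works on `Λ = ℤ^d`, where the question does not arise.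
[cite: BenfattoEtAl1978, §5 p.154 + Lemma p.152 (the setting `ℤ^d`)] -/
theorem not_pad_of_coordMax_mem {J Λ : Finset (Fin d → ℤ)} {r : ℝ} (hr : 1 ≤ r) {x : Fin d → ℤ} (hx : x ∈ J) {i : Fin d}
    (hmax : ∀ y ∈ Λ, y i ≤ x i) :
    ¬ ∀ x ∈ J, ∀ z : Fin d → ℤ, (∀ i, (|z i - x i| : ℝ) ≤ r) → z ∈ Λ := by
  intro hpad
  have hmem := update_succ_mem_of_pad hr hpad hx i
  have := hmax _ hmem
  rw [Function.update_self] at this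
  linarith

/-- ★ **READING (α) AS A KERNEL FACT: a non-empty finite frame admits no pad of itself.**  If the Hamiltonian's support is the whole frame (`J = Λ ≠ ∅`, `d ≥ 1`), the admissibility
letter `∀ x ∈ J, ∀ z, (∀ i, |z i − x i| ≤ r) → z ∈ Λ` is FALSE for every `r ≥ 1` (take `x ∈ Λ` maximizing the first coordinate).
[cite: BenfattoEtAl1978, Lemma p.152 (ℤ^d setting); Balaban1985UV3, (20)–(22) p.261 (terms over all of Ω₁)] -/
theorem not_pad_self (hd : 0 < d) {Λ : Finset (Fin d → ℤ)} (hΛ : Λ.Nonempty) {r : ℝ} (hr : 1 ≤ r) :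
    ¬ ∀ x ∈ Λ, ∀ z : Fin d → ℤ, (∀ i, (|z i - x i| : ℝ) ≤ r) → z ∈ Λ := by
  obtain ⟨x, hx, hmax⟩ := Λ.exists_max_image (fun y : Fin d → ℤ => y ⟨0, hd⟩) hΛ
  exact not_pad_of_coordMax_mem hr hx (i := ⟨0, hd⟩) hmax

/-- **… at the knit's radius `r = b²`, `b ≥ 1`** (CLAIM-20's letter verbatim: `(∀ i, (|z i − x i| : ℝ) ≤ b ^ 2) → z ∈ Λ`). [cite: BenfattoEtAl1978, §5 p.154, b* p.159] -/
theorem not_pad_self_sq (hd : 0 < d) {Λ : Finset (Fin d → ℤ)} (hΛ : Λ.Nonempty) {b : ℝ} (hb : 1 ≤ b) :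
    ¬ ∀ x ∈ Λ, ∀ z : Fin d → ℤ, (∀ i, (|z i - x i| : ℝ) ≤ b ^ 2) → z ∈ Λ :=
  not_pad_self hd hΛ (by nlinarith)

end Pad

/-! ## §2 Pad versus collar at the socket's threshold `b = p(g)` (reading (β)) -/

section Collar

/-- `r(g) > 0` on `(0, 1]`. [cite: Balaban1985UV3, (7) p.257] -/
theorem rFun_pos (r₀ : ℝ) {g : ℝ} (hg : 0 < g) (hg1 : g ≤ 1) : 0 < B10.rFun r₀ g := by
  unfold B10.rFun
  have hu : 1 ≤ 1 + Real.log g⁻¹ := by linarith [B10.log_inv_nonneg_of_le_one hg hg1]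
  exact Real.rpow_pos_of_pos (lt_of_lt_of_le one_pos hu) _

/-- `p(g)² = b₀²·(1 + log g⁻¹)^{2p₀}` on `(0, 1]`. [cite: Balaban1985UV3, (7) p.257] -/
theorem pFun_sq_eq (b₀ p₀ : ℝ) {g : ℝ} (hg : 0 < g) (hg1 : g ≤ 1) : B10.pFun b₀ p₀ g ^ 2 = b₀ ^ 2 * (1 + Real.log g⁻¹) ^ (2 * p₀) := by
  have hu : 0 ≤ 1 + Real.log g⁻¹ := by linarith [B10.log_inv_nonneg_of_le_one hg hg1]
  unfold B10.pFun
  rw [mul_pow, show (2 : ℝ) * p₀ = p₀ * ((2 : ℕ) : ℝ) by push_cast; ring, Real.rpow_mul hu, Real.rpow_natCast]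

/-- ★ **`C·r(g) < p(g)²` once `C < b₀²·(1 + log g⁻¹)`**, for exponents with `r₀ + 1 ≤ 2p₀` (so `(1 + log g⁻¹)^{2p₀ − r₀} ≥ 1 + log g⁻¹`), `0 < g ≤ 1`.
[cite: Balaban1985UV3, (7) p.257 (p, r); BenfattoEtAl1978, §5 p.154 (pad b²)] -/
theorem mul_rFun_lt_pFun_sq_of_lt {b₀ p₀ r₀ C g : ℝ} (he : r₀ + 1 ≤ 2 * p₀) (hg : 0 < g) (hg1 : g ≤ 1)
    (hC : C < b₀ ^ 2 * (1 + Real.log g⁻¹)) : C * B10.rFun r₀ g < B10.pFun b₀ p₀ g ^ 2 := by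
  set u : ℝ := 1 + Real.log g⁻¹ with hu_def
  have hu1 : 1 ≤ u := by rw [hu_def]; linarith [B10.log_inv_nonneg_of_le_one hg hg1]
  have hu0 : 0 < u := lt_of_lt_of_le one_pos hu1
  have hr : 0 < B10.rFun r₀ g := rFun_pos r₀ hg hg1
  rw [pFun_sq_eq b₀ p₀ hg hg1]
  have hsplit : u ^ (2 * p₀) = u ^ r₀ * u ^ (2 * p₀ - r₀) := by
    rw [← Real.rpow_add hu0]; congr 1; ring
  have hge : u ≤ u ^ (2 * p₀ - r₀) := by
    calc u = u ^ (1 : ℝ) := (Real.rpow_one u).symm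
      _ ≤ u ^ (2 * p₀ - r₀) := Real.rpow_le_rpow_of_exponent_le hu1 (by linarith)
  have hrdef : B10.rFun r₀ g = u ^ r₀ := rfl
  calc C * B10.rFun r₀ g < b₀ ^ 2 * u * B10.rFun r₀ g := mul_lt_mul_of_pos_right hC hr
    _ = b₀ ^ 2 * (u ^ r₀ * u) := by rw [hrdef]; ring
    _ ≤ b₀ ^ 2 * (u ^ r₀ * u ^ (2 * p₀ - r₀)) :=
        mul_le_mul_of_nonneg_left (mul_le_mul_of_nonneg_left hge (Real.rpow_nonneg hu0.le _)) (sq_nonneg _)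
    _ = b₀ ^ 2 * u ^ (2 * p₀) := by rw [hsplit]

/-- ★★ **READING (β) AS A KERNEL FACT: at small coupling the pad `p(g)²` exceeds every multiple `C·r(g)` of the collar profile.**  For `b₀ > 0`, `r₀ + 1 ≤ 2p₀` and ANY `C`
there is `g₁ ∈ (0, 1]` with `C·r(g) < p(g)²` for all `g ∈ (0, g₁]` (`g₁ = min 1 (exp(−|C|∕b₀²))`).  With `C := R₁M₁` (print's collar «distances to P > R M₁, R = R₁ r(g)» (7) p.257, in
sites of `T₁`) this says the collar never supplies the knit's pad at the socket's threshold `b = p(g)`.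
[cite: Balaban1985UV3, (7) p.257 + (39) p.266 + (41) p.266; BenfattoEtAl1978, §5 p.154] -/
theorem exists_coupling_mul_rFun_lt_pFun_sq {b₀ p₀ r₀ : ℝ} (hb₀ : 0 < b₀) (he : r₀ + 1 ≤ 2 * p₀) (C : ℝ) :
    ∃ g₁ : ℝ, 0 < g₁ ∧ g₁ ≤ 1 ∧ ∀ g : ℝ, 0 < g → g ≤ g₁ → C * B10.rFun r₀ g < B10.pFun b₀ p₀ g ^ 2 := by
  have hb2 : 0 < b₀ ^ 2 := pow_pos hb₀ 2
  refine ⟨min 1 (Real.exp (-(|C| / b₀ ^ 2))), lt_min one_pos (Real.exp_pos _), min_le_left _ _, fun g hg hgle => ?_⟩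
  have hg1 : g ≤ 1 := hgle.trans (min_le_left _ _)
  have hge : g ≤ Real.exp (-(|C| / b₀ ^ 2)) := hgle.trans (min_le_right _ _)
  refine mul_rFun_lt_pFun_sq_of_lt he hg hg1 ?_
  -- `log g⁻¹ ≥ |C| / b₀²`, hence `b₀²(1 + log g⁻¹) ≥ b₀² + |C| > C`
  have hlog : |C| / b₀ ^ 2 ≤ Real.log g⁻¹ := by
    rw [Real.log_inv]
    have h1 : Real.log g ≤ -(|C| / b₀ ^ 2) := by
      rw [← Real.log_exp (-(|C| / b₀ ^ 2))]
      exact Real.log_le_log hg hge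
    linarith
  have h2 : b₀ ^ 2 * (|C| / b₀ ^ 2) = |C| := mul_div_cancel₀ _ hb2.ne'
  have h3 : b₀ ^ 2 * (|C| / b₀ ^ 2) ≤ b₀ ^ 2 * Real.log g⁻¹ := mul_le_mul_of_nonneg_left hlog hb2.le
  have h4 : C ≤ |C| := le_abs_self C
  nlinarith

variable {N : ℕ} (𝔠 : AlphaConsts L N)

/-- `r₀ + 1 ≤ 2p₀` at every record (`p₀ = 2r₀ + 1`, `r₀ ≥ 1`). [cite: Balaban1985UV3, (7) p.257] -/
theorem r₀_add_one_le_two_mul_p₀ : 𝔠.r₀ + 1 ≤ 2 * 𝔠.p₀ := by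
  have := 𝔠.one_le_r₀
  unfold AlphaConsts.p₀
  linarith

/-- ★★ **AT EVERY CONSTANTS RECORD: the collar `C·r(g)` is eventually below the pad `p(g)²`** (the record's own `b₀ > 0`, `p₀ = 2r₀ + 1`; any `C`, e.g. `C = R₁M₁`).
[cite: Balaban1985UV3, (7) p.257 + (39)∕(41) p.266; BenfattoEtAl1978, §5 p.154] -/
theorem exists_coupling_collar_lt_pad_rec (C : ℝ) :
    ∃ g₁ : ℝ, 0 < g₁ ∧ g₁ ≤ 1 ∧ ∀ g : ℝ, 0 < g → g ≤ g₁ → C * B10.rFun 𝔠.r₀ g < B10.pFun 𝔠.b₀ 𝔠.p₀ g ^ 2 :=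
  exists_coupling_mul_rFun_lt_pFun_sq 𝔠.b₀_pos (r₀_add_one_le_two_mul_p₀ 𝔠) C

/-- **… at the run's couplings**: for every lattice approximation `S` and step `k` with `g_k ≤ g₁`: `C·r(g_k) < p(g_k)²` — the steps at which the (α)-socket is consumed (`g_k ≤ η₀`)
are exactly the small-coupling steps. [cite: Balaban1985UV3, (5) p.256 + (7) p.257 + (41) p.266] -/
theorem collar_lt_pad_at_run (C : ℝ) :
    ∃ g₁ : ℝ, 0 < g₁ ∧ g₁ ≤ 1 ∧ ∀ (S : Scales L) (k : ℕ), S.gk k ≤ g₁ →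
      C * B10.rFun 𝔠.r₀ (S.gk k) < B10.pFun 𝔠.b₀ 𝔠.p₀ (S.gk k) ^ 2 := by
  obtain ⟨g₁, hg₁, hg₁1, h⟩ := exists_coupling_collar_lt_pad_rec 𝔠 C
  exact ⟨g₁, hg₁, hg₁1, fun S k hk => h _ (gk_pos S k) hk⟩

end Collar

end Summit.QuantumFields.YangMills.Theorems.BalabanUVNodesN08AlphaEq324RowClassSocketPad

end
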